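import Literature.NumberTheory.Sieve.HeathBrownCubicCubeSums
import HarnessLib

/-!
# The norm form near a level: `vol{𝐱 ∈ 𝒞 : |N(𝐱) − A| ≤ δ} ≪ S₀²δV^{−2/3}` (for Heath-Brown's (8.5), `n = 0`)

Layer of the decomposition of **parity.S18**
(`Literature.NumberTheory.Sieve.setOf_prime_cube_add_two_mul_cube_infinite`) along D. R. Heath-Brown,
*Primes represented by `x³ + 2y³`*, Acta Math. 186 (2001), 1–84. In the proof of Lemma 8.1 the
comparison (8.5) of `∑_{β ≡ γ (mod r)} w'(N(β))` with `r⁻³𝓘` uses, for `n = 0` (where `w'` is the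
indicator of `J(m₁) = [a, b)` and the Lipschitz bound (8.3) is not available), a count of the cells on
which `N` crosses the level `a` or `b`: "Since `𝐱·∇N(𝐱) = 3N(𝐱) ≫ V` (8.6), we have
`|∇N(𝐱)| ≫ V^{2/3}`, so that Lemma 4.9 may be applied … The number of cubes for which (8.6) fails is
therefore `O(S₀²r⁻²)`" (pp. 49–50); and in §9 the same geometry appears as "When `𝐱` is confined to the
cube `𝒞`, the set for which `|N(𝐱) − a| ≤ ΔV` has measure `O(ΔV)`" (p. 58, for (9.19)). This file PROVES
the measure statement in a quantitative form sufficient for both uses (the cell count of p. 50 follows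
from it in `HeathBrownCubicCubeSumsZero`, replacing the appeal to the general Lemma 4.9):

* `volume_sublevel_depressedCubic_le` — for `α > 0`, `κ > 0`:
  `vol{t ∈ ℝ : |αt³ + βt + γ − A| ≤ δ, |3αt² + β| ≥ κ} ≤ 6δ/κ` (three monotone pieces, each of diameter
  `≤ 2δ/κ` by the factorisation `p(t₂) − p(t₁) = (t₂ − t₁)(α(t₂² + t₁t₂ + t₁²) + β)`; no calculus);
* `euler_normForm` (`xN_x + yN_y + zN_z = 3N`), `exists_le_abs_dN` (on a cube with `|x_j| ≤ c₃V^{1/3}`,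
  `N ≥ c₄V`, some `|N_{x_j}| ≥ κ := c₄V/(c₃V^{1/3})`);
* `volume_slab₁_le`, `volume_slab₂_le`, `volume_slab₃_le` — the part of `{𝐱 ∈ 𝒞 : |N(𝐱) − A| ≤ δ}`
  where `|N_{x_j}| ≥ κ` has volume `≤ (6δ/κ)S₀²` (Tonelli along `x_j`; along each coordinate line `N` is a
  depressed cubic `αt³ + βt + γ` with `α = 1, 2, 4`);
* **`volume_normForm_near_le`** — `vol{𝐱 ∈ 𝒞 : |N(𝐱) − A| ≤ δ} ≤ 18δS₀²c₃V^{1/3}/(c₄V)`.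

## References

* D. R. Heath-Brown, *Primes represented by `x³ + 2y³`*, Acta Math. 186 (2001), 1–84: §8 pp. 49–50
  ((8.6) and the application of Lemma 4.9), §9 p. 58. [cite: HeathBrownActa2001, §9 p. 58]

## Mathlib / tree search

Mathlib: `Real.volume_le_diam`, `Metric.ediam_le`, `Measure.prod_apply`, `Measure.prod_apply_symm`,
`measurable_prodMk_left`, `lintegral_indicator_const`, `measurableSet_le`; nothing on sublevel sets of
polynomials. Tree: `HeathBrownCubicCubeSums` (`continuous_normForm`, `measurableSet_realCube`,
`mem_realCube`), `HeathBrownCubicSiegelWalfisz` (`normForm`), `HeathBrownCubicTypeII` (`CubeCond`, `realCube`).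
-/

noncomputable section

open MeasureTheory Set

namespace Literature.NumberTheory.Sieve.CubicSieve

/-! ### One variable: the depressed cubic `p(t) = αt³ + βt + γ` where `|p'(t)| ≥ κ` -/

section OneVar

/-- A set of reals any two of whose points are within `d` has measure at most `d`. [folklore] -/
theorem volume_le_of_forall_abs_sub_le {S : Set ℝ} {d : ℝ} (h : ∀ t₁ ∈ S, ∀ t₂ ∈ S, |t₂ - t₁| ≤ d) :
    volume S ≤ ENNReal.ofReal d := by
  refine (Real.volume_le_diam S).trans (Metric.ediam_le fun x hx y hy => ?_)
  rw [edist_dist, Real.dist_eq, abs_sub_comm]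
  exact ENNReal.ofReal_le_ofReal (h x hx y hy)

/-- The difference quotient of a depressed cubic: `p(t₂) − p(t₁) = (t₂ − t₁)(α(t₂² + t₁t₂ + t₁²) + β)`.
[folklore] -/
theorem depressedCubic_sub (α β γ t₁ t₂ : ℝ) :
    (α * t₂ ^ 3 + β * t₂ + γ) - (α * t₁ ^ 3 + β * t₁ + γ) =
      (t₂ - t₁) * (α * (t₂ ^ 2 + t₁ * t₂ + t₁ ^ 2) + β) := by
  ring

/-- On a piece where the difference quotient is at least `κ` in absolute value, two points at which
`p` is within `δ` of `A` are within `2δ/κ` of each other. [folklore] -/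
theorem abs_sub_le_of_quotient {α β γ A δ κ t₁ t₂ : ℝ} (hκ : 0 < κ)
    (hQ : κ ≤ |α * (t₂ ^ 2 + t₁ * t₂ + t₁ ^ 2) + β|)
    (h₁ : |α * t₁ ^ 3 + β * t₁ + γ - A| ≤ δ) (h₂ : |α * t₂ ^ 3 + β * t₂ + γ - A| ≤ δ) :
    |t₂ - t₁| ≤ 2 * δ / κ := by
  have hdiff : |(α * t₂ ^ 3 + β * t₂ + γ) - (α * t₁ ^ 3 + β * t₁ + γ)| ≤ 2 * δ := by
    calc |(α * t₂ ^ 3 + β * t₂ + γ) - (α * t₁ ^ 3 + β * t₁ + γ)|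
        = |(α * t₂ ^ 3 + β * t₂ + γ - A) - (α * t₁ ^ 3 + β * t₁ + γ - A)| := by ring_nf
      _ ≤ |α * t₂ ^ 3 + β * t₂ + γ - A| + |α * t₁ ^ 3 + β * t₁ + γ - A| := abs_sub _ _
      _ ≤ 2 * δ := by linarith
  rw [depressedCubic_sub, abs_mul] at hdiff
  rw [le_div_iff₀ hκ]
  calc |t₂ - t₁| * κ ≤ |t₂ - t₁| * |α * (t₂ ^ 2 + t₁ * t₂ + t₁ ^ 2) + β| :=
        mul_le_mul_of_nonneg_left hQ (abs_nonneg _)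
    _ ≤ 2 * δ := hdiff

/-- **Sublevel sets of a depressed cubic away from its critical points**: for `α > 0`, `κ > 0`,
`vol{t : |αt³ + βt + γ − A| ≤ δ, |3αt² + β| ≥ κ} ≤ 6δ/κ`. The set splits into the three pieces
`{3αt² + β ≥ κ, t ≥ 0}`, `{3αt² + β ≥ κ, t ≤ 0}`, `{3αt² + β ≤ −κ}`, on each of which the difference
quotient `α(t₂² + t₁t₂ + t₁²) + β` of any two points is `≥ κ` in absolute value (it is at least
`3α min(t₁, t₂)² + β`, resp. at least `3α min(|t₁|, |t₂|)² + β`, resp. at most `3α max(t₁², t₂²) + β`),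
so each piece has diameter `≤ 2δ/κ`. [folklore] -/
theorem volume_sublevel_depressedCubic_le {α β γ A δ κ : ℝ} (hα : 0 < α) (hκ : 0 < κ) :
    volume {t : ℝ | |α * t ^ 3 + β * t + γ - A| ≤ δ ∧ κ ≤ |3 * α * t ^ 2 + β|} ≤
      ENNReal.ofReal (6 * δ / κ) := by
  set P : ℝ → Prop := fun t => |α * t ^ 3 + β * t + γ - A| ≤ δ with hP
  set S₁ := {t : ℝ | P t ∧ κ ≤ 3 * α * t ^ 2 + β ∧ 0 ≤ t} with hS₁
  set S₂ := {t : ℝ | P t ∧ κ ≤ 3 * α * t ^ 2 + β ∧ t ≤ 0} with hS₂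
  set S₃ := {t : ℝ | P t ∧ 3 * α * t ^ 2 + β ≤ -κ} with hS₃
  have hsub : {t : ℝ | |α * t ^ 3 + β * t + γ - A| ≤ δ ∧ κ ≤ |3 * α * t ^ 2 + β|} ⊆ S₁ ∪ S₂ ∪ S₃ := by
    intro t ht
    obtain ⟨hPt, hκt⟩ := ht
    rcases le_abs'.mp hκt with h | h
    · exact Or.inr ⟨hPt, h⟩
    · rcases le_total 0 t with ht0 | ht0
      · exact Or.inl (Or.inl ⟨hPt, h, ht0⟩)
      · exact Or.inl (Or.inr ⟨hPt, h, ht0⟩)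
  -- each piece has diameter `≤ 2δ/κ`
  have h1 : volume S₁ ≤ ENNReal.ofReal (2 * δ / κ) := by
    refine volume_le_of_forall_abs_sub_le fun t₁ ht₁ t₂ ht₂ => ?_
    obtain ⟨hP₁, hκ₁, h0₁⟩ := ht₁
    obtain ⟨hP₂, hκ₂, h0₂⟩ := ht₂
    refine abs_sub_le_of_quotient hκ (le_trans ?_ (le_abs_self _)) hP₁ hP₂
    rcases le_total t₁ t₂ with h12 | h12
    · nlinarith [mul_nonneg h0₁ (sub_nonneg.mpr h12)]
    · nlinarith [mul_nonneg h0₂ (sub_nonneg.mpr h12)]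
  have h2 : volume S₂ ≤ ENNReal.ofReal (2 * δ / κ) := by
    refine volume_le_of_forall_abs_sub_le fun t₁ ht₁ t₂ ht₂ => ?_
    obtain ⟨hP₁, hκ₁, h0₁⟩ := ht₁
    obtain ⟨hP₂, hκ₂, h0₂⟩ := ht₂
    refine abs_sub_le_of_quotient hκ (le_trans ?_ (le_abs_self _)) hP₁ hP₂
    rcases le_total t₁ t₂ with h12 | h12
    · nlinarith [mul_nonneg (neg_nonneg.mpr h0₂) (sub_nonneg.mpr h12)]
    · nlinarith [mul_nonneg (neg_nonneg.mpr h0₁) (sub_nonneg.mpr h12)]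
  have h3 : volume S₃ ≤ ENNReal.ofReal (2 * δ / κ) := by
    refine volume_le_of_forall_abs_sub_le fun t₁ ht₁ t₂ ht₂ => ?_
    obtain ⟨hP₁, hκ₁⟩ := ht₁
    obtain ⟨hP₂, hκ₂⟩ := ht₂
    refine abs_sub_le_of_quotient hκ (le_trans ?_ (neg_le_abs _)) hP₁ hP₂
    -- `α(t₂² + t₁t₂ + t₁²) + β ≤ 3α max(t₁², t₂²) + β ≤ −κ`
    rcases le_total (t₁ ^ 2) (t₂ ^ 2) with h12 | h12
    · nlinarith [sq_nonneg (t₁ - t₂), mul_nonneg hα.le (sub_nonneg.mpr h12)]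
    · nlinarith [sq_nonneg (t₁ - t₂), mul_nonneg hα.le (sub_nonneg.mpr h12)]
  have hδκ : ENNReal.ofReal (6 * δ / κ) =
      ENNReal.ofReal (2 * δ / κ) + ENNReal.ofReal (2 * δ / κ) + ENNReal.ofReal (2 * δ / κ) := by
    rcases le_or_gt 0 δ with hδ | hδ
    · have h0 : 0 ≤ 2 * δ / κ := by positivity
      rw [← ENNReal.ofReal_add h0 h0, ← ENNReal.ofReal_add (by positivity) h0]
      congr 1; ring
    · have h0 : 2 * δ / κ ≤ 0 := div_nonpos_of_nonpos_of_nonneg (by linarith) hκ.le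
      have h0' : 6 * δ / κ ≤ 0 := div_nonpos_of_nonpos_of_nonneg (by linarith) hκ.le
      rw [ENNReal.ofReal_of_nonpos h0, ENNReal.ofReal_of_nonpos h0', add_zero, add_zero]
  calc volume {t : ℝ | |α * t ^ 3 + β * t + γ - A| ≤ δ ∧ κ ≤ |3 * α * t ^ 2 + β|}
      ≤ volume (S₁ ∪ S₂ ∪ S₃) := measure_mono hsub
    _ ≤ volume S₁ + volume S₂ + volume S₃ :=
        (measure_union_le _ _).trans (add_le_add (measure_union_le _ _) le_rfl)
    _ ≤ ENNReal.ofReal (2 * δ / κ) + ENNReal.ofReal (2 * δ / κ) + ENNReal.ofReal (2 * δ / κ) :=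
        add_le_add (add_le_add h1 h2) h3
    _ = ENNReal.ofReal (6 * δ / κ) := hδκ.symm

end OneVar

/-! ### Three variables: Euler's identity and slicing along the coordinate with a large derivative -/

section ThreeVar

/-- `∂N/∂x = 3x² − 6yz`. [folklore] -/
def dN₁ (p : ℝ × ℝ × ℝ) : ℝ := 3 * p.1 ^ 2 - 6 * p.2.1 * p.2.2

/-- `∂N/∂y = 6y² − 6xz`. [folklore] -/
def dN₂ (p : ℝ × ℝ × ℝ) : ℝ := 6 * p.2.1 ^ 2 - 6 * p.1 * p.2.2

/-- `∂N/∂z = 12z² − 6xy`. [folklore] -/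
def dN₃ (p : ℝ × ℝ × ℝ) : ℝ := 12 * p.2.2 ^ 2 - 6 * p.1 * p.2.1

/-- **Euler's identity** for the cubic form `N`: `x N_x + y N_y + z N_z = 3N` ("`𝐱·∇N(𝐱) = 3N(𝐱) ≫ V`",
p. 49). [cite: HeathBrownActa2001, §8 p. 49] -/
theorem euler_normForm (p : ℝ × ℝ × ℝ) : p.1 * dN₁ p + p.2.1 * dN₂ p + p.2.2 * dN₃ p = 3 * normForm p := by
  simp only [dN₁, dN₂, dN₃, normForm]; ring

/-- On a cube as in Lemma 3.8 (`|x|, |y|, |z| ≤ c₃V^{1/3}`, `N ≥ c₄V`), at every point some partial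
derivative of `N` is at least `κ = c₄V/(c₃V^{1/3})` in absolute value ("we have `|∇N(𝐱)| ≫ V^{2/3}`",
p. 50). [cite: HeathBrownActa2001, §8 p. 50] -/
theorem exists_le_abs_dN {c₃ c₄ V : ℝ} (hc₃ : 0 < c₃) (hV : 0 < V) {a : ℝ × ℝ × ℝ} {S₀ : ℝ}
    (hcube : CubeCond c₃ c₄ V a S₀) {p : ℝ × ℝ × ℝ} (hp : p ∈ realCube a S₀) :
    c₄ * V / (c₃ * V ^ (1 / 3 : ℝ)) ≤ |dN₁ p| ∨ c₄ * V / (c₃ * V ^ (1 / 3 : ℝ)) ≤ |dN₂ p| ∨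
      c₄ * V / (c₃ * V ^ (1 / 3 : ℝ)) ≤ |dN₃ p| := by
  set R := c₃ * V ^ (1 / 3 : ℝ) with hR
  have hRpos : 0 < R := by positivity
  obtain ⟨h1, h2, h3, hN⟩ := hcube p hp
  have hN' : c₄ * V ≤ normForm p := hN
  by_contra hcon
  simp only [not_or, not_le] at hcon
  obtain ⟨k1, k2, k3⟩ := hcon
  have hE := euler_normForm p
  have e1 : p.1 * dN₁ p ≤ R * |dN₁ p| :=
    (le_abs_self _).trans (by rw [abs_mul]; exact mul_le_mul_of_nonneg_right h1 (abs_nonneg _))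
  have e2 : p.2.1 * dN₂ p ≤ R * |dN₂ p| :=
    (le_abs_self _).trans (by rw [abs_mul]; exact mul_le_mul_of_nonneg_right h2 (abs_nonneg _))
  have e3 : p.2.2 * dN₃ p ≤ R * |dN₃ p| :=
    (le_abs_self _).trans (by rw [abs_mul]; exact mul_le_mul_of_nonneg_right h3 (abs_nonneg _))
  have f1 : R * |dN₁ p| < R * (c₄ * V / R) := mul_lt_mul_of_pos_left k1 hRpos
  have f2 : R * |dN₂ p| < R * (c₄ * V / R) := mul_lt_mul_of_pos_left k2 hRpos
  have f3 : R * |dN₃ p| < R * (c₄ * V / R) := mul_lt_mul_of_pos_left k3 hRpos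
  have hRκ : R * (c₄ * V / R) = c₄ * V := by field_simp
  linarith

variable {a : ℝ × ℝ × ℝ} {S₀ : ℝ}

/-- The slab `|N − A| ≤ δ` of the cube where `|N_x| ≥ κ`. [folklore] -/
def slab₁ (a : ℝ × ℝ × ℝ) (S₀ A δ κ : ℝ) : Set (ℝ × ℝ × ℝ) :=
  {p | p ∈ realCube a S₀ ∧ |normForm p - A| ≤ δ ∧ κ ≤ |dN₁ p|}

/-- The slab `|N − A| ≤ δ` of the cube where `|N_y| ≥ κ`. [folklore] -/
def slab₂ (a : ℝ × ℝ × ℝ) (S₀ A δ κ : ℝ) : Set (ℝ × ℝ × ℝ) :=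
  {p | p ∈ realCube a S₀ ∧ |normForm p - A| ≤ δ ∧ κ ≤ |dN₂ p|}

/-- The slab `|N − A| ≤ δ` of the cube where `|N_z| ≥ κ`. [folklore] -/
def slab₃ (a : ℝ × ℝ × ℝ) (S₀ A δ κ : ℝ) : Set (ℝ × ℝ × ℝ) :=
  {p | p ∈ realCube a S₀ ∧ |normForm p - A| ≤ δ ∧ κ ≤ |dN₃ p|}

/-- Continuity of the partial derivatives. [folklore] -/
theorem continuous_dN : Continuous dN₁ ∧ Continuous dN₂ ∧ Continuous dN₃ := by
  exact ⟨by unfold dN₁; fun_prop, by unfold dN₂; fun_prop, by unfold dN₃; fun_prop⟩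

/-- The slabs are measurable. [folklore] -/
theorem measurableSet_slab (A δ κ : ℝ) :
    MeasurableSet (slab₁ a S₀ A δ κ) ∧ MeasurableSet (slab₂ a S₀ A δ κ) ∧ MeasurableSet (slab₃ a S₀ A δ κ) := by
  have hN : Measurable fun p : ℝ × ℝ × ℝ => |normForm p - A| :=
    ((continuous_normForm.sub continuous_const).abs).measurable
  have hle : MeasurableSet {p : ℝ × ℝ × ℝ | |normForm p - A| ≤ δ} := measurableSet_le hN measurable_const
  obtain ⟨c1, c2, c3⟩ := continuous_dN
  refine ⟨?_, ?_, ?_⟩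
  · exact (measurableSet_realCube a S₀).inter (hle.inter (measurableSet_le measurable_const c1.abs.measurable))
  · exact (measurableSet_realCube a S₀).inter (hle.inter (measurableSet_le measurable_const c2.abs.measurable))
  · exact (measurableSet_realCube a S₀).inter (hle.inter (measurableSet_le measurable_const c3.abs.measurable))

/-- **The slab where `|N_x| ≥ κ` has volume `≤ (6δ/κ)S₀²`** (slice along `x`: each line meets it in a
set of measure `≤ 6δ/κ`, `volume_sublevel_depressedCubic_le` with `N = x³ − 6yz·x + (2y³ + 4z³)`).
[folklore] -/
theorem volume_slab₁_le (hS₀ : 0 ≤ S₀) (A : ℝ) {δ κ : ℝ} (hδ : 0 ≤ δ) (hκ : 0 < κ) :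
    volume (slab₁ a S₀ A δ κ) ≤ ENNReal.ofReal (6 * δ / κ * S₀ ^ 2) := by
  have hmeas := (measurableSet_slab (a := a) (S₀ := S₀) A δ κ).1
  set sqr : Set (ℝ × ℝ) := Set.Ioc a.2.1 (a.2.1 + S₀) ×ˢ Set.Ioc a.2.2 (a.2.2 + S₀) with hsqr
  have hsqm : MeasurableSet sqr := measurableSet_Ioc.prod measurableSet_Ioc
  have hsqvol : volume sqr = ENNReal.ofReal (S₀ ^ 2) := by
    rw [hsqr, Measure.volume_eq_prod, Measure.prod_prod, Real.volume_Ioc, Real.volume_Ioc, add_sub_cancel_left,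
      add_sub_cancel_left, ← ENNReal.ofReal_mul hS₀, pow_two]
  have hsec : ∀ yz : ℝ × ℝ, volume ((fun x : ℝ => (x, yz)) ⁻¹' slab₁ a S₀ A δ κ) ≤
      sqr.indicator (fun _ => ENNReal.ofReal (6 * δ / κ)) yz := by
    intro yz
    by_cases hyz : yz ∈ sqr
    · rw [Set.indicator_of_mem hyz]
      refine le_trans (measure_mono ?_)
        (volume_sublevel_depressedCubic_le (α := 1) (β := -6 * yz.1 * yz.2) (γ := 2 * yz.1 ^ 3 + 4 * yz.2 ^ 3)
          (A := A) (δ := δ) one_pos hκ)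
      intro x hx
      simp only [Set.mem_preimage, slab₁, Set.mem_setOf_eq, normForm, dN₁] at hx
      obtain ⟨-, hNx, hdx⟩ := hx
      refine ⟨?_, ?_⟩
      · convert hNx using 2; ring
      · convert hdx using 2; ring
    · rw [Set.indicator_of_notMem hyz]
      have hempty : (fun x : ℝ => (x, yz)) ⁻¹' slab₁ a S₀ A δ κ = ∅ := by
        ext x
        simp only [Set.mem_preimage, slab₁, Set.mem_setOf_eq, Set.mem_empty_iff_false, iff_false, not_and]
        intro hx
        exact absurd (⟨(mem_realCube.mp hx).2.1, (mem_realCube.mp hx).2.2⟩ : yz ∈ sqr) hyz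
      rw [hempty, measure_empty]
  calc volume (slab₁ a S₀ A δ κ)
      = ∫⁻ yz, volume ((fun x : ℝ => (x, yz)) ⁻¹' slab₁ a S₀ A δ κ) := by
        rw [Measure.volume_eq_prod, Measure.prod_apply_symm hmeas]
    _ ≤ ∫⁻ yz, sqr.indicator (fun _ => ENNReal.ofReal (6 * δ / κ)) yz := lintegral_mono hsec
    _ = ENNReal.ofReal (6 * δ / κ) * volume sqr := lintegral_indicator_const hsqm _
    _ = ENNReal.ofReal (6 * δ / κ * S₀ ^ 2) := by
        rw [hsqvol, ← ENNReal.ofReal_mul (by positivity)]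

/-- **The slab where `|N_y| ≥ κ` has volume `≤ (6δ/κ)S₀²`** (slice along `y`: `N = 2y³ − 6xz·y + (x³ + 4z³)`).
[folklore] -/
theorem volume_slab₂_le (hS₀ : 0 ≤ S₀) (A : ℝ) {δ κ : ℝ} (hδ : 0 ≤ δ) (hκ : 0 < κ) :
    volume (slab₂ a S₀ A δ κ) ≤ ENNReal.ofReal (6 * δ / κ * S₀ ^ 2) := by
  have hmeas := (measurableSet_slab (a := a) (S₀ := S₀) A δ κ).2.1
  set C := ENNReal.ofReal (6 * δ / κ) with hC
  set I₁ : Set ℝ := Set.Ioc a.1 (a.1 + S₀) with hI₁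
  set I₃ : Set ℝ := Set.Ioc a.2.2 (a.2.2 + S₀) with hI₃
  have hI₁m : MeasurableSet I₁ := measurableSet_Ioc
  have hI₃m : MeasurableSet I₃ := measurableSet_Ioc
  have hI₁v : volume I₁ = ENNReal.ofReal S₀ := by rw [hI₁, Real.volume_Ioc, add_sub_cancel_left]
  have hI₃v : volume I₃ = ENNReal.ofReal S₀ := by rw [hI₃, Real.volume_Ioc, add_sub_cancel_left]
  -- the `y`-sections
  have hsecY : ∀ x z : ℝ, volume ((fun y : ℝ => (y, z)) ⁻¹' (Prod.mk x ⁻¹' slab₂ a S₀ A δ κ)) ≤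
      I₁.indicator (fun _ => I₃.indicator (fun _ => C) z) x := by
    intro x z
    by_cases hx : x ∈ I₁
    · by_cases hz : z ∈ I₃
      · rw [Set.indicator_of_mem hx, Set.indicator_of_mem hz]
        refine le_trans (measure_mono ?_)
          (volume_sublevel_depressedCubic_le (α := 2) (β := -6 * x * z) (γ := x ^ 3 + 4 * z ^ 3)
            (A := A) (δ := δ) two_pos hκ)
        intro y hy
        simp only [Set.mem_preimage, slab₂, Set.mem_setOf_eq, normForm, dN₂] at hy
        obtain ⟨-, hNy, hdy⟩ := hy
        refine ⟨?_, ?_⟩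
        · convert hNy using 2; ring
        · convert hdy using 2; ring
      · rw [Set.indicator_of_mem hx, Set.indicator_of_notMem hz]
        have hempty : (fun y : ℝ => (y, z)) ⁻¹' (Prod.mk x ⁻¹' slab₂ a S₀ A δ κ) = ∅ := by
          ext y
          simp only [Set.mem_preimage, slab₂, Set.mem_setOf_eq, Set.mem_empty_iff_false, iff_false, not_and]
          intro hy
          exact absurd (mem_realCube.mp hy).2.2 hz
        rw [hempty, measure_empty]
    · rw [Set.indicator_of_notMem hx]
      have hempty : (fun y : ℝ => (y, z)) ⁻¹' (Prod.mk x ⁻¹' slab₂ a S₀ A δ κ) = ∅ := by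
        ext y
        simp only [Set.mem_preimage, slab₂, Set.mem_setOf_eq, Set.mem_empty_iff_false, iff_false, not_and]
        intro hy
        exact absurd (mem_realCube.mp hy).1 hx
      rw [hempty, measure_empty]
  -- the `(y, z)`-sections
  have hsecYZ : ∀ x : ℝ, volume (Prod.mk x ⁻¹' slab₂ a S₀ A δ κ) ≤ I₁.indicator (fun _ => C * volume I₃) x := by
    intro x
    have hmx : MeasurableSet (Prod.mk x ⁻¹' slab₂ a S₀ A δ κ) := measurable_prodMk_left hmeas
    calc volume (Prod.mk x ⁻¹' slab₂ a S₀ A δ κ)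
        = ∫⁻ z, volume ((fun y : ℝ => (y, z)) ⁻¹' (Prod.mk x ⁻¹' slab₂ a S₀ A δ κ)) := by
          rw [Measure.volume_eq_prod, Measure.prod_apply_symm hmx]
      _ ≤ ∫⁻ z, I₁.indicator (fun _ => I₃.indicator (fun _ => C) z) x := lintegral_mono (hsecY x)
      _ = I₁.indicator (fun _ => C * volume I₃) x := by
          by_cases hx : x ∈ I₁
          · simp only [Set.indicator_of_mem hx]
            exact lintegral_indicator_const hI₃m _
          · simp only [Set.indicator_of_notMem hx, lintegral_zero]
  calc volume (slab₂ a S₀ A δ κ) = ∫⁻ x, volume (Prod.mk x ⁻¹' slab₂ a S₀ A δ κ) := by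
        rw [Measure.volume_eq_prod, Measure.prod_apply hmeas]
    _ ≤ ∫⁻ x, I₁.indicator (fun _ => C * volume I₃) x := lintegral_mono hsecYZ
    _ = C * volume I₃ * volume I₁ := lintegral_indicator_const hI₁m _
    _ = ENNReal.ofReal (6 * δ / κ * S₀ ^ 2) := by
        rw [hI₁v, hI₃v, hC, ← ENNReal.ofReal_mul (by positivity), ← ENNReal.ofReal_mul (by positivity)]
        ring_nf

/-- **The slab where `|N_z| ≥ κ` has volume `≤ (6δ/κ)S₀²`** (slice along `z`: `N = 4z³ − 6xy·z + (x³ + 2y³)`).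
[folklore] -/
theorem volume_slab₃_le (hS₀ : 0 ≤ S₀) (A : ℝ) {δ κ : ℝ} (hδ : 0 ≤ δ) (hκ : 0 < κ) :
    volume (slab₃ a S₀ A δ κ) ≤ ENNReal.ofReal (6 * δ / κ * S₀ ^ 2) := by
  have hmeas := (measurableSet_slab (a := a) (S₀ := S₀) A δ κ).2.2
  set C := ENNReal.ofReal (6 * δ / κ) with hC
  set I₁ : Set ℝ := Set.Ioc a.1 (a.1 + S₀) with hI₁
  set I₂ : Set ℝ := Set.Ioc a.2.1 (a.2.1 + S₀) with hI₂
  have hI₁m : MeasurableSet I₁ := measurableSet_Ioc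
  have hI₂m : MeasurableSet I₂ := measurableSet_Ioc
  have hI₁v : volume I₁ = ENNReal.ofReal S₀ := by rw [hI₁, Real.volume_Ioc, add_sub_cancel_left]
  have hI₂v : volume I₂ = ENNReal.ofReal S₀ := by rw [hI₂, Real.volume_Ioc, add_sub_cancel_left]
  -- the `z`-sections
  have hsecZ : ∀ x y : ℝ, volume (Prod.mk y ⁻¹' (Prod.mk x ⁻¹' slab₃ a S₀ A δ κ)) ≤
      I₁.indicator (fun _ => I₂.indicator (fun _ => C) y) x := by
    intro x y
    by_cases hx : x ∈ I₁
    · by_cases hy : y ∈ I₂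
      · rw [Set.indicator_of_mem hx, Set.indicator_of_mem hy]
        refine le_trans (measure_mono ?_)
          (volume_sublevel_depressedCubic_le (α := 4) (β := -6 * x * y) (γ := x ^ 3 + 2 * y ^ 3)
            (A := A) (δ := δ) (by norm_num) hκ)
        intro z hz
        simp only [Set.mem_preimage, slab₃, Set.mem_setOf_eq, normForm, dN₃] at hz
        obtain ⟨-, hNz, hdz⟩ := hz
        refine ⟨?_, ?_⟩
        · convert hNz using 2; ring
        · convert hdz using 2; ring
      · rw [Set.indicator_of_mem hx, Set.indicator_of_notMem hy]
        have hempty : Prod.mk y ⁻¹' (Prod.mk x ⁻¹' slab₃ a S₀ A δ κ) = ∅ := by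
          ext z
          simp only [Set.mem_preimage, slab₃, Set.mem_setOf_eq, Set.mem_empty_iff_false, iff_false, not_and]
          intro hz
          exact absurd (mem_realCube.mp hz).2.1 hy
        rw [hempty, measure_empty]
    · rw [Set.indicator_of_notMem hx]
      have hempty : Prod.mk y ⁻¹' (Prod.mk x ⁻¹' slab₃ a S₀ A δ κ) = ∅ := by
        ext z
        simp only [Set.mem_preimage, slab₃, Set.mem_setOf_eq, Set.mem_empty_iff_false, iff_false, not_and]
        intro hz
        exact absurd (mem_realCube.mp hz).1 hx
      rw [hempty, measure_empty]
  have hsecYZ : ∀ x : ℝ, volume (Prod.mk x ⁻¹' slab₃ a S₀ A δ κ) ≤ I₁.indicator (fun _ => C * volume I₂) x := by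
    intro x
    have hmx : MeasurableSet (Prod.mk x ⁻¹' slab₃ a S₀ A δ κ) := measurable_prodMk_left hmeas
    calc volume (Prod.mk x ⁻¹' slab₃ a S₀ A δ κ)
        = ∫⁻ y, volume (Prod.mk y ⁻¹' (Prod.mk x ⁻¹' slab₃ a S₀ A δ κ)) := by
          rw [Measure.volume_eq_prod, Measure.prod_apply hmx]
      _ ≤ ∫⁻ y, I₁.indicator (fun _ => I₂.indicator (fun _ => C) y) x := lintegral_mono (hsecZ x)
      _ = I₁.indicator (fun _ => C * volume I₂) x := by
          by_cases hx : x ∈ I₁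
          · simp only [Set.indicator_of_mem hx]
            exact lintegral_indicator_const hI₂m _
          · simp only [Set.indicator_of_notMem hx, lintegral_zero]
  calc volume (slab₃ a S₀ A δ κ) = ∫⁻ x, volume (Prod.mk x ⁻¹' slab₃ a S₀ A δ κ) := by
        rw [Measure.volume_eq_prod, Measure.prod_apply hmeas]
    _ ≤ ∫⁻ x, I₁.indicator (fun _ => C * volume I₂) x := lintegral_mono hsecYZ
    _ = C * volume I₂ * volume I₁ := lintegral_indicator_const hI₁m _
    _ = ENNReal.ofReal (6 * δ / κ * S₀ ^ 2) := by
        rw [hI₁v, hI₂v, hC, ← ENNReal.ofReal_mul (by positivity), ← ENNReal.ofReal_mul (by positivity)]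
        ring_nf

/-- **The norm form near a level.** For a cube `𝒞` as in Lemma 3.8 (`|x|, |y|, |z| ≤ c₃V^{1/3}` and
`N ≥ c₄V` on `𝒞`, `c₃, c₄, V > 0`, side `S₀ ≥ 0`) and `δ ≥ 0`,
`vol{𝐱 ∈ 𝒞 : |N(𝐱) − A| ≤ δ} ≤ 18 δ S₀² c₃V^{1/3}/(c₄V)` (`= 18(c₃/c₄)S₀²δV^{−2/3}`): the quantitative
form of "when `𝐱` is confined to the cube `𝒞`, the set for which `|N(𝐱) − a| ≤ ΔV` has measure `O(ΔV)`"
(p. 58, used there for (9.19), and — through Lemma 4.9 — for (8.5) with `n = 0`, p. 50); by Euler's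
identity some `|N_{x_j}| ≥ c₄V/(c₃V^{1/3})` at each point, and each of the three slabs has volume
`≤ 6δS₀²/κ`. [cite: HeathBrownActa2001, §9 p. 58] -/
theorem volume_normForm_near_le {c₃ c₄ V : ℝ} (hc₃ : 0 < c₃) (hc₄ : 0 < c₄) (hV : 0 < V)
    (hS₀ : 0 ≤ S₀) (hcube : CubeCond c₃ c₄ V a S₀) (A : ℝ) {δ : ℝ} (hδ : 0 ≤ δ) :
    volume {p : ℝ × ℝ × ℝ | p ∈ realCube a S₀ ∧ |normForm p - A| ≤ δ} ≤
      ENNReal.ofReal (18 * δ * S₀ ^ 2 * (c₃ * V ^ (1 / 3 : ℝ)) / (c₄ * V)) := by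
  set κ : ℝ := c₄ * V / (c₃ * V ^ (1 / 3 : ℝ)) with hκ
  have hκpos : 0 < κ := by positivity
  have hsub : {p : ℝ × ℝ × ℝ | p ∈ realCube a S₀ ∧ |normForm p - A| ≤ δ} ⊆
      slab₁ a S₀ A δ κ ∪ slab₂ a S₀ A δ κ ∪ slab₃ a S₀ A δ κ := by
    rintro p ⟨hp, hN⟩
    rcases exists_le_abs_dN hc₃ hV hcube hp with h | h | h
    · exact Or.inl (Or.inl ⟨hp, hN, h⟩)
    · exact Or.inl (Or.inr ⟨hp, hN, h⟩)
    · exact Or.inr ⟨hp, hN, h⟩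
  have h6 : 0 ≤ 6 * δ / κ * S₀ ^ 2 := by positivity
  calc volume {p : ℝ × ℝ × ℝ | p ∈ realCube a S₀ ∧ |normForm p - A| ≤ δ}
      ≤ volume (slab₁ a S₀ A δ κ ∪ slab₂ a S₀ A δ κ ∪ slab₃ a S₀ A δ κ) := measure_mono hsub
    _ ≤ volume (slab₁ a S₀ A δ κ) + volume (slab₂ a S₀ A δ κ) + volume (slab₃ a S₀ A δ κ) :=
        (measure_union_le _ _).trans (add_le_add (measure_union_le _ _) le_rfl)
    _ ≤ ENNReal.ofReal (6 * δ / κ * S₀ ^ 2) + ENNReal.ofReal (6 * δ / κ * S₀ ^ 2) +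
          ENNReal.ofReal (6 * δ / κ * S₀ ^ 2) :=
        add_le_add (add_le_add (volume_slab₁_le hS₀ A hδ hκpos) (volume_slab₂_le hS₀ A hδ hκpos))
          (volume_slab₃_le hS₀ A hδ hκpos)
    _ = ENNReal.ofReal (18 * δ * S₀ ^ 2 * (c₃ * V ^ (1 / 3 : ℝ)) / (c₄ * V)) := by
        rw [← ENNReal.ofReal_add h6 h6, ← ENNReal.ofReal_add (by positivity) h6]
        congr 1
        rw [hκ]
        field_simp
        ring

end ThreeVar

end Literature.NumberTheory.Sieve.CubicSieve

end
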